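import Summits.QuantumFields.YangMills.Theorems.BalabanLadderNTMirrorHankelTorus
import Summits.QuantumFields.YangMills.Theorems.UniversalDetectorMirrorPositivity
import Summits.QuantumFields.YangMills.Theorems.UniversalDetectorTorusPeriodicity
import Summits.QuantumFields.YangMills.Theorems.BalabanLadderInfVolRPSquare
import Summits.QuantumFields.YangMills.Theorems.LangevinControlUVOSLegsFromFemtoAndGapStubCollar6
import Summits.QuantumFields.YangMills.Theorems.SquareRootCeilingsMirrorDominationRPCS
import HarnessLib

/-!
# Route `UniversalDetector`, LINE g10-1 «Hankel tightness» — the mirror (Hankel) structure of the plane kernels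

Ideator seat ym-idea-8 (generation 10, lens «dual»); toolkit for the support item `UniversalDetector.HankelCeiling`
(stmt-QuantumFields-24000) of rung R2a (`BalabanLadder.NT`).  Route-independent lattice facts, valid for EVERY compact
`G`, every lattice representation `r`, every `β ≥ 0` and every odd torus `2L+1`:

* `sq_mirrorCov_le` — the two-observable reflection-positivity Cauchy–Schwarz inequality in `torusE` letters:
  `Cov_T(F∘Θ₀, H)² ≤ Cov_T(F∘Θ₀, F) · Cov_T(H∘Θ₀, H)` for bounded continuous cylinders `F, H` with links based at
  times in `[0, L−1]` (`Θ₀ = cfgReflect`; tree `Reflection.sq_cov_negReflect_le_odd_pos` transported along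
  `torusLift ∘ ϑ = Θ₀ ∘ torusLift`);
* `diagCov` — the DIAGONAL time-axis plane kernel `D_q(m) = Cov_T(plane_q 0, plane_q (m e₀))`, its periodicity and
  evenness, and its identification with the spine's mirror sequence of the cylinder `W = plane_q 0`:
  `D_q(n + δ_q) = latticeConnectedCorr (W∘Θ₀) W n` (`δ_q = 1` for the three electric species, `0` for the magnetic
  ones — the exact reflection law `plane_cfgReflect`), hence `D_q ≥ 0` and LOG-CONVEX on the reflection window;
* `diagCov_le_edge` — the HANKEL MAXIMUM PRINCIPLE: a non-negative log-convex sequence on an interval that is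
  symmetric about the antipode takes its maximum at the edge, `D_q(m) ≤ D_q(m_e)` for `m_e ≤ m ≤ 2L+1−m_e`;
* `sq_cov_plane_le_diagCov` — CENTRING: every plane–plane covariance at a site `z` with `z₀ ≥ 1` is a mirror
  pairing, so `Cov_T(plane_p 0, plane_q z)² ≤ D_p(2s+δ_p) · D_q(2(z₀−s−δ_p)+δ_q)` for any admissible split `s`.

Together (file `UniversalDetectorHankelCeiling`): a ceiling on the diagonal kernels at ONE edge lag bounds every
plane kernel at every site whose dominant coordinate is at least that lag — the (EDGE) ⇒ boundedness half of the
line.  HONEST FRAMING: lattice identities and inequalities only; no continuum statement, no summit, rung or crux is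
proved here; not Clay.  Refs: Osterwalder–Seiler, Ann. Phys. 110 (1978) §2; Fröhlich–Israel–Lieb–Simon, Comm. Math.
Phys. 62 (1978) Thm. 2.1; Glimm–Jaffe, *Quantum Physics* (1987) §6.1 [folklore: log-convexity of RP sequences].
-/

set_option autoImplicit false

noncomputable section

open MeasureTheory Filter Topology
open Literature.MathematicalPhysics.QuantumFieldTheory Literature.MathematicalPhysics.QuantumLattice
  Literature.Probability.LatticeModels
open Summit.QuantumFields.YangMills.Cruxes.OSLegsFromFemtoAndGap.DlrCollarTransfer
open Summit.QuantumFields.YangMills.Cruxes.NT.MarkovMirror (dependsOn_posHalf_of_window)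
open Summit.QuantumFields.YangMills.Cruxes.NT.Reflection (sq_cov_negReflect_le_odd_pos)
open Summit.QuantumFields.YangMills.Cruxes.NT.MirrorHankel (latticeConnectedCorr_eq_torusCov
  latticeConnectedCorr_mirror_nonneg latticeConnectedCorr_mirror_logConvex pow_le_pow_mul_pow_of_logConvex)
open Summit.QuantumFields.YangMills.Cruxes.UniversalDetectorPlaneTight (cov_plane_translate cov_plane_zero_neg
  cov_plane_add_period plane_configShift_neg)
open Summit.QuantumFields.YangMills.Theorems.InfVolRP (reflSite plane_cfgReflect)
open Summit.QuantumFields.YangMills.Theorems.OSLegsFromFemtoAndGap (torusE_plane_eq_wilsonTorusMean)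
open Summit.QuantumFields.YangMills.Theorems.MirrorDomination (torusE_plane_site)

namespace Summit.QuantumFields.YangMills.Cruxes.UniversalDetectorHankel

variable (G : Type) [Group G] [TopologicalSpace G] [IsTopologicalGroup G] [CompactSpace G]
  [MeasurableSpace G] [BorelSpace G] (r : LatticeRep G)

/-! ## §1 Two-observable reflection-positivity Cauchy–Schwarz in `torusE` letters -/

/-- **RPCS, torus form, two observables.**  For bounded continuous cylinders `F, H` of `ℤ⁴` with links based at times
in `[0, L−1]`, on the torus `2L+1` (`L ≥ 1`) at `β ≥ 0`:
`(E_T[F∘Θ₀·H] − E_T F·E_T H)² ≤ (E_T[F∘Θ₀·F] − (E_T F)²)·(E_T[H∘Θ₀·H] − (E_T H)²)`.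
[cite: FrohlichIsraelLiebSimon1978, Thm. 2.1] -/
theorem sq_mirrorCov_le {β : ℝ} (hβ : 0 ≤ β) {L : ℕ} (hL : 1 ≤ L) {F H : LGConfig 4 G → ℝ}
    (hFc : Continuous F) (hHc : Continuous H) {MF MH : ℝ} (hMF : ∀ U, |F U| ≤ MF) (hMH : ∀ U, |H U| ≤ MH)
    {SF SH : Finset (Literature.MathematicalPhysics.QuantumLattice.ZdEdge 4)} (hFS : IsCylinder F SF)
    (hHS : IsCylinder H SH) (hSF : ∀ e ∈ SF, 0 ≤ e.1 0 ∧ e.1 0 + 1 ≤ (L : ℤ))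
    (hSH : ∀ e ∈ SH, 0 ≤ e.1 0 ∧ e.1 0 + 1 ≤ (L : ℤ)) :
    (torusE G r β L (fun V => F (cfgReflect V) * H V) - torusE G r β L F * torusE G r β L H) ^ 2 ≤
      (torusE G r β L (fun V => F (cfgReflect V) * F V) - torusE G r β L F ^ 2) *
        (torusE G r β L (fun V => H (cfgReflect V) * H V) - torusE G r β L H ^ 2) := by
  haveI := r.secondCountableTopology
  have hposF := dependsOn_posHalf_of_window (G := G) L hFS hSF
  have hposH := dependsOn_posHalf_of_window (G := G) L hHS hSH
  have hFm : Measurable fun U : GaugeConfig 4 (2 * L + 1) G => F (torusLift (2 * L + 1) U) :=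
    (hFc.comp (continuous_torusLift _)).measurable
  have hHm : Measurable fun U : GaugeConfig 4 (2 * L + 1) G => H (torusLift (2 * L + 1) U) :=
    (hHc.comp (continuous_torusLift _)).measurable
  have key := sq_cov_negReflect_le_odd_pos r.ρ (S := L) rfl hL r.continuous hβ hFm hHm
    ⟨MF, fun U => hMF _⟩ ⟨MH, fun U => hMH _⟩ hposF hposH
  unfold torusE
  simp only [torusLift_negReflect] at key
  exact key

/-! ## §2 Plane fields: windows, means, the reflected site -/

omit [IsTopologicalGroup G] [CompactSpace G] [BorelSpace G] in
/-- The links of the plane field at `x` are based at times in `[x₀, x₀+1]`; with `0 ≤ x₀` and `x₀ + 2 ≤ L` they lie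
in the window `[0, L−1]`. [folklore] -/
theorem supp_plane_timeWindow (q : Fin 4 × Fin 4) (x : Site 4) {L : ℕ} (h0 : 0 ≤ x 0) (h2 : x 0 + 2 ≤ (L : ℤ)) :
    ∀ e ∈ (originPlaquetteSupport q.1 q.2).image (fun e => (e.1 - -x, e.2)), 0 ≤ e.1 0 ∧ e.1 0 + 1 ≤ (L : ℤ) := by
  intro e he
  have h := near_of_mem_supp_plane he 0
  constructor <;> linarith [h.1, h.2]

/-- The electric indicator of a species: `1` for the three electric planes `(0, j)`, `0` for the magnetic ones. -/
def elec (p : Fin 4 × Fin 4) : ℤ := if p.1 = 0 then 1 else 0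

omit [Group G] [TopologicalSpace G] [IsTopologicalGroup G] [CompactSpace G] [MeasurableSpace G] [BorelSpace G] in
/-- `0 ≤ δ_p`. -/
theorem elec_nonneg (p : Fin 4 × Fin 4) : 0 ≤ elec p := by
  unfold elec; split_ifs <;> norm_num

omit [Group G] [TopologicalSpace G] [IsTopologicalGroup G] [CompactSpace G] [MeasurableSpace G] [BorelSpace G] in
/-- `δ_p ≤ 1`. -/
theorem elec_le_one (p : Fin 4 × Fin 4) : elec p ≤ 1 := by
  unfold elec; split_ifs <;> norm_num

omit [Group G] [TopologicalSpace G] [IsTopologicalGroup G] [CompactSpace G] [MeasurableSpace G] [BorelSpace G] in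
/-- The reflected site of a pure-time site: `reflSite p (s e₀) = −(s + δ_p) e₀`. [folklore] -/
theorem reflSite_single (p : Fin 4 × Fin 4) (s : ℤ) :
    reflSite p (Pi.single 0 s) = -Pi.single 0 (s + elec p) := by
  funext k
  unfold reflSite elec
  by_cases hk : k = 0
  · subst hk
    simp only [Pi.sub_apply, siteReflect_apply_zero, Pi.single_eq_same, Pi.neg_apply]
    split_ifs
    · simp; ring
    · simp
  · simp only [Pi.sub_apply, siteReflect_apply_of_ne _ hk, Pi.single_eq_of_ne hk, Pi.neg_apply]
    split_ifs <;> simp [Pi.single_eq_of_ne hk]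

omit [Group G] [TopologicalSpace G] [IsTopologicalGroup G] [CompactSpace G] [MeasurableSpace G] [BorelSpace G] in
/-- `x − reflSite q x = (2x₀ + δ_q) e₀`. [folklore] -/
theorem sub_reflSite (q : Fin 4 × Fin 4) (x : Site 4) :
    x - reflSite q x = Pi.single 0 (2 * x 0 + elec q) := by
  funext k
  unfold reflSite elec
  by_cases hk : k = 0
  · subst hk
    simp only [Pi.sub_apply, siteReflect_apply_zero, Pi.single_eq_same]
    split_ifs
    · simp; ring
    · simp; ring
  · simp only [Pi.sub_apply, siteReflect_apply_of_ne _ hk, Pi.single_eq_of_ne hk]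
    split_ifs <;> simp [Pi.single_eq_of_ne hk]

/-! ## §3 The diagonal time-axis kernel and its mirror structure -/

/-- The diagonal time-axis plane kernel `D_q(m) = Cov_T(plane_q 0, plane_q (m e₀))` (unnormalised). -/
def diagCov (β : ℝ) (L : ℕ) (q : Fin 4 × Fin 4) (m : ℤ) : ℝ :=
  torusE G r β L (fun V => plane G r q 0 V * plane G r q (Pi.single 0 m) V) -
    torusE G r β L (plane G r q 0) * torusE G r β L (plane G r q (Pi.single 0 m))

/-- Periodicity `D_q(m + (2L+1)) = D_q(m)`. [folklore] -/
theorem diagCov_add_period (β : ℝ) (L : ℕ) (q : Fin 4 × Fin 4) (m : ℤ) :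
    diagCov G r β L q (m + ((2 * L + 1 : ℕ) : ℤ)) = diagCov G r β L q m := by
  unfold diagCov
  have h := cov_plane_add_period r β L q q 0 (Pi.single 0 m) (Pi.single 0 1)
  have e : (Pi.single 0 m : Site 4) + (((2 * L + 1 : ℕ) : ℤ)) • (Pi.single 0 1 : Site 4) =
      Pi.single 0 (m + ((2 * L + 1 : ℕ) : ℤ)) := by
    rw [← Pi.single_smul, Pi.single_add]; simp
  rw [e] at h
  exact h

/-- Evenness `D_q(−m) = D_q(m)`. [folklore] -/
theorem diagCov_neg (β : ℝ) (L : ℕ) (q : Fin 4 × Fin 4) (m : ℤ) :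
    diagCov G r β L q (-m) = diagCov G r β L q m := by
  unfold diagCov
  have h := cov_plane_zero_neg r β L q q (Pi.single 0 m)
  rw [← Pi.single_neg] at h
  exact h

/-- **The diagonal kernel is a shifted mirror sequence**: with `W = plane_q 0`,
`D_q(n + δ_q) = latticeConnectedCorr (W∘Θ₀) W n` — the reflected plane field is the plane field at the reflected site,
electric plaquettes one unit lower (`plane_cfgReflect`). [cite: OsterwalderSeiler1978, §2] -/
theorem diagCov_eq_mirror (β : ℝ) (L : ℕ) {q : Fin 4 × Fin 4} (hq : q.1 < q.2) (n : ℕ) :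
    diagCov G r β L q ((n : ℤ) + elec q) =
      latticeConnectedCorr r.ρ β (2 * L + 1) (fun V => plane G r q 0 (cfgReflect V)) (plane G r q 0) n := by
  rw [latticeConnectedCorr_eq_torusCov G r β L (plane G r q 0) n]
  have hrefl : ∀ V, plane G r q 0 (cfgReflect V) = plane G r q (-Pi.single 0 (elec q)) V := fun V => by
    rw [plane_cfgReflect r hq 0 V]
    have h := reflSite_single q (0 : ℤ)
    rw [Pi.single_zero, zero_add] at h
    rw [h]
  have hshift : ∀ V, plane G r q 0 (configShift (-(Pi.single 0 (n : ℤ))) V) = plane G r q (Pi.single 0 (n : ℤ)) V :=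
    fun V => by
      have h := plane_configShift_neg r q (Pi.single 0 (n : ℤ)) (Pi.single 0 (n : ℤ)) V
      rwa [sub_self] at h
  simp only [hrefl, hshift]
  rw [show (fun V => plane G r q (-Pi.single 0 (elec q)) V) = plane G r q (-Pi.single 0 (elec q)) from rfl,
    torusE_plane_site G r β L q 0 (Pi.single 0 (n : ℤ)),
    cov_plane_translate r β L q q (-Pi.single 0 (elec q)) (Pi.single 0 (n : ℤ))]
  have hs : (Pi.single 0 (n : ℤ) : Site 4) - -Pi.single 0 (elec q) = Pi.single 0 ((n : ℤ) + elec q) := by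
    rw [sub_neg_eq_add, ← Pi.single_add]
  rw [hs]
  rfl

/-- **Non-negativity on the reflection window**: `0 ≤ D_q(n + δ_q)` for `n + 4 ≤ 2L` (`β ≥ 0`, `L ≥ 1`).
[cite: OsterwalderSeiler1978, §2] -/
theorem diagCov_mirror_nonneg {β : ℝ} (hβ : 0 ≤ β) {L : ℕ} (hL : 1 ≤ L) {q : Fin 4 × Fin 4} (hq : q.1 < q.2)
    {n : ℕ} (hn : n + 4 ≤ 2 * L) : 0 ≤ diagCov G r β L q ((n : ℤ) + elec q) := by
  haveI := r.secondCountableTopology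
  obtain ⟨K, hK⟩ := exists_abs_plane_le r
  rw [diagCov_eq_mirror G r β L hq n]
  exact latticeConnectedCorr_mirror_nonneg (r := r) (T := 2) hβ hL (continuous_plane r q 0).measurable (hK q 0)
    (isCylinder_plane r q 0) (fun e he => by
      have h := near_of_mem_supp_plane he 0
      simp only [Pi.zero_apply, sub_zero] at h
      constructor <;> push_cast <;> linarith [h.1, h.2]) (by omega)

/-- **Log-convexity on the reflection window**: `D_q(n+1+δ_q)² ≤ D_q(n+δ_q) · D_q(n+2+δ_q)` for `n + 6 ≤ 2L`.
[cite: FrohlichIsraelLiebSimon1978, Thm. 2.1] -/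
theorem diagCov_mirror_logConvex {β : ℝ} (hβ : 0 ≤ β) {L : ℕ} (hL : 1 ≤ L) {q : Fin 4 × Fin 4} (hq : q.1 < q.2)
    {n : ℕ} (hn : n + 6 ≤ 2 * L) :
    diagCov G r β L q (((n + 1 : ℕ) : ℤ) + elec q) ^ 2 ≤
      diagCov G r β L q ((n : ℤ) + elec q) * diagCov G r β L q (((n + 2 : ℕ) : ℤ) + elec q) := by
  haveI := r.secondCountableTopology
  obtain ⟨K, hK⟩ := exists_abs_plane_le r
  rw [diagCov_eq_mirror G r β L hq n, diagCov_eq_mirror G r β L hq (n + 1), diagCov_eq_mirror G r β L hq (n + 2)]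
  exact latticeConnectedCorr_mirror_logConvex (r := r) (T := 2) hβ hL (continuous_plane r q 0).measurable (hK q 0)
    (isCylinder_plane r q 0) (fun e he => by
      have h := near_of_mem_supp_plane he 0
      simp only [Pi.zero_apply, sub_zero] at h
      constructor <;> push_cast <;> linarith [h.1, h.2]) (by omega)

/-- **Hankel maximum principle.**  For `5 ≤ m_e ≤ L` (`β ≥ 0`) the diagonal kernel on the lags `m_e ≤ m ≤ 2L+1−m_e`
is non-negative and bounded by its value at the edge lag: `0 ≤ D_q(m) ≤ D_q(m_e)` — a non-negative log-convex sequence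
on an interval symmetric under `m ↦ 2L+1−m` (periodicity and evenness) takes its maximum at the ends.
[cite: GlimmJaffe1987, §6.1] -/
theorem diagCov_le_edge {β : ℝ} (hβ : 0 ≤ β) {L : ℕ} {q : Fin 4 × Fin 4} (hq : q.1 < q.2) {me : ℕ}
    (hme5 : 5 ≤ me) (hmeL : me ≤ L) {m : ℤ} (hm1 : (me : ℤ) ≤ m) (hm2 : m ≤ 2 * (L : ℤ) + 1 - me) :
    0 ≤ diagCov G r β L q m ∧ diagCov G r β L q m ≤ diagCov G r β L q me := by
  have hL : 1 ≤ L := by omega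
  have hδ0 := elec_nonneg q
  have hδ1 := elec_le_one q
  -- the reindexed sequence `E v = D_q(m_e + v)` on `[0, U]`, `U = 2L + 1 − 2 m_e`
  set U : ℕ := 2 * L + 1 - 2 * me with hU
  set E : ℕ → ℝ := fun v => diagCov G r β L q ((me : ℤ) + v) with hE
  -- every lag `m_e + v`, `v ≤ U`, is `n + δ_q` with `n + 4 ≤ 2L`
  have hcase : elec q = 0 ∨ elec q = 1 := by unfold elec; split_ifs <;> simp
  have hrepr : ∀ v : ℕ, ∃ n : ℕ, ((me : ℤ) + v = (n : ℤ) + elec q) ∧ (n : ℤ) = me + v - elec q := by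
    intro v
    refine ⟨(me + v) - (elec q).toNat, ?_, ?_⟩
    · rcases hcase with h | h <;> simp only [h, Int.toNat_zero, Int.toNat_one, Nat.sub_zero, add_zero] <;> push_cast <;> omega
    · rcases hcase with h | h <;> simp only [h, Int.toNat_zero, Int.toNat_one, Nat.sub_zero, sub_zero] <;> push_cast <;> omega
  have htoNat : ((elec q).toNat : ℤ) = elec q := Int.toNat_of_nonneg hδ0
  have hnn : ∀ v, v ≤ U → 0 ≤ E v := by
    intro v hv
    obtain ⟨n, hn, hnv⟩ := hrepr v
    simp only [hE, hn]
    exact diagCov_mirror_nonneg G r hβ hL hq (by omega)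
  have hlc : ∀ v, 0 < v → v < U → E v ^ 2 ≤ E (v - 1) * E (v + 1) := by
    intro v hv0 hvU
    obtain ⟨n, hn, hnv⟩ := hrepr (v - 1)
    have e0 : E (v - 1) = diagCov G r β L q ((n : ℤ) + elec q) := by simp only [hE, hn]
    have e1 : E v = diagCov G r β L q (((n + 1 : ℕ) : ℤ) + elec q) := by
      simp only [hE]; congr 1; push_cast; have : ((v : ℕ) : ℤ) = ((v - 1 : ℕ) : ℤ) + 1 := by omega
      linarith
    have e2 : E (v + 1) = diagCov G r β L q (((n + 2 : ℕ) : ℤ) + elec q) := by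
      simp only [hE]; congr 1; push_cast; have : ((v : ℕ) : ℤ) = ((v - 1 : ℕ) : ℤ) + 1 := by omega
      linarith
    rw [e0, e1, e2]
    exact diagCov_mirror_logConvex G r hβ hL hq (by omega)
  -- the far end of the window is the edge again: `D_q(2L+1−m_e) = D_q(−m_e) = D_q(m_e)`
  have hEU : E U = E 0 := by
    simp only [hE, Nat.cast_zero, add_zero]
    have h1 : ((me : ℤ) + (U : ℕ)) = -(me : ℤ) + ((2 * L + 1 : ℕ) : ℤ) := by
      have : 2 * me ≤ 2 * L + 1 := by omega
      simp only [hU]; push_cast [this]; omega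
    rw [h1, diagCov_add_period, diagCov_neg]
  -- the three-point inequality `E u ^ U ≤ E 0 ^ (U−u) · E U ^ u = E 0 ^ U`
  have hu : (m - me).toNat ≤ U := by
    have : (m - me).toNat = m - me := Int.toNat_of_nonneg (by omega)
    omega
  have hmu : ((me : ℤ) + ((m - me).toNat : ℕ)) = m := by
    rw [Int.toNat_of_nonneg (by omega)]; ring
  have key := pow_le_pow_mul_pow_of_logConvex E U hnn hlc hu
  rw [hEU, ← pow_add, Nat.sub_add_cancel hu] at key
  have hEu : E (m - me).toNat = diagCov G r β L q m := by simp only [hE, hmu]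
  have hE0 : E 0 = diagCov G r β L q me := by simp only [hE, Nat.cast_zero, add_zero]
  have hUpos : U ≠ 0 := by omega
  have h0u : 0 ≤ E (m - me).toNat := hnn _ hu
  have h00 : 0 ≤ E 0 := hnn 0 (Nat.zero_le _)
  refine ⟨hEu ▸ h0u, ?_⟩
  rw [← hEu, ← hE0]
  exact (pow_le_pow_iff_left₀ h0u h00 hUpos).1 key

/-! ## §4 Centring: every plane–plane covariance is a mirror pairing -/

/-- **Centring.**  For `β ≥ 0`, species `p, q`, a site `z` and a split `s : ℕ` with `0 ≤ z₀ − s − δ_p`, `s + 2 ≤ L`,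
`z₀ − s − δ_p + 2 ≤ L`:  `Cov_T(plane_p 0, plane_q z)² ≤ D_p(2s + δ_p) · D_q(2(z₀ − s − δ_p) + δ_q)` — the pair is the
mirror pairing of `plane_p (s e₀)` and `plane_q (z − (s+δ_p) e₀)`, and the two diagonal mirror forms are diagonal
kernels at pure time lags. [cite: FrohlichIsraelLiebSimon1978, Thm. 2.1] -/
theorem sq_cov_plane_le_diagCov {β : ℝ} (hβ : 0 ≤ β) {L : ℕ} (hL : 1 ≤ L) {p q : Fin 4 × Fin 4} (hp : p.1 < p.2)
    (hq : q.1 < q.2) (z : Site 4) (s : ℕ) (hy0 : 0 ≤ z 0 - s - elec p) (hs2 : (s : ℤ) + 2 ≤ L)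
    (hy2 : z 0 - s - elec p + 2 ≤ L) :
    (torusE G r β L (fun V => plane G r p 0 V * plane G r q z V) -
        torusE G r β L (plane G r p 0) * torusE G r β L (plane G r q z)) ^ 2 ≤
      diagCov G r β L p (2 * s + elec p) * diagCov G r β L q (2 * (z 0 - s - elec p) + elec q) := by
  obtain ⟨K, hK⟩ := exists_abs_plane_le r
  set x : Site 4 := Pi.single 0 (s : ℤ) with hx
  set y : Site 4 := z - Pi.single 0 ((s : ℤ) + elec p) with hy
  have hx0 : x 0 = s := by simp [hx]
  have hy0' : y 0 = z 0 - s - elec p := by simp [hy]; ring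
  have key := sq_mirrorCov_le G r hβ hL (continuous_plane r p x) (continuous_plane r q y) (hK p x) (hK q y)
    (isCylinder_plane r p x) (isCylinder_plane r q y)
    (supp_plane_timeWindow p x (by rw [hx0]; exact_mod_cast Nat.zero_le s) (by rw [hx0]; exact hs2))
    (supp_plane_timeWindow q y (by rw [hy0']; exact hy0) (by rw [hy0']; exact hy2))
  -- identify the three mirror forms
  have hrx : reflSite p x = -Pi.single 0 ((s : ℤ) + elec p) := by rw [hx]; exact reflSite_single p s
  have e1 : torusE G r β L (fun V => plane G r p x (cfgReflect V) * plane G r q y V) -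
      torusE G r β L (plane G r p x) * torusE G r β L (plane G r q y) =
      torusE G r β L (fun V => plane G r p 0 V * plane G r q z V) -
        torusE G r β L (plane G r p 0) * torusE G r β L (plane G r q z) := by
    simp only [plane_cfgReflect r hp]
    rw [torusE_plane_site G r β L p x (reflSite p x), cov_plane_translate r β L p q (reflSite p x) y]
    have : y - reflSite p x = z := by rw [hrx, hy, sub_neg_eq_add, sub_add_cancel]
    rw [this]
  have e2 : torusE G r β L (fun V => plane G r p x (cfgReflect V) * plane G r p x V) - torusE G r β L (plane G r p x) ^ 2 =
      diagCov G r β L p (2 * s + elec p) := by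
    simp only [plane_cfgReflect r hp]
    rw [sq]
    nth_rewrite 1 [torusE_plane_site G r β L p x (reflSite p x)]
    rw [cov_plane_translate r β L p p (reflSite p x) x, sub_reflSite, hx0]
    rfl
  have e3 : torusE G r β L (fun V => plane G r q y (cfgReflect V) * plane G r q y V) - torusE G r β L (plane G r q y) ^ 2 =
      diagCov G r β L q (2 * (z 0 - s - elec p) + elec q) := by
    simp only [plane_cfgReflect r hq]
    rw [sq]
    nth_rewrite 1 [torusE_plane_site G r β L q y (reflSite q y)]
    rw [cov_plane_translate r β L q q (reflSite q y) y, sub_reflSite, hy0']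
    rfl
  rw [e1, e2, e3] at key
  exact key

end Summit.QuantumFields.YangMills.Cruxes.UniversalDetectorHankel

end
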